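import Literature.NumberTheory.Automorphic.CongruenceSubgroupExpansionGL
import HarnessLib

/-!
# Congruence classes of matrices modulo `ϖ^N` under `K_m × K_m`, pinned diagonal matrices,
the shift element and its transversal

Topic `NumberTheory/Automorphic`. Second support file of the discharge of
`GodementJacquet1972_local_existsUnique_hasGJLFactor` (`GodementJacquetLocal`; Godement–Jacquet,
LNM 260 (1972), Thm. 3.3 (2)), after `GodementJacquetZetaHeckeShift`. Pure matrix algebra over a
field `F` with a `ValuativeRel`, an element `ϖ` (mostly a uniformizing element,
`IsUniformizingElement`) and the principal congruence subgroups
`K_m = congruenceGL n |ϖ|^m = 1 + ϖ^m M_n(𝒪)` (`GLnCongruenceSubgroups`,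
`CongruenceSubgroupExpansionGL`), `m ≥ 1`.

* `gjClass ϖ m N Y` (**definition**) — the set of matrices `X` with `X ≡ k Y k' (mod ϖ^N M_n(𝒪))`
  for some `k, k' ∈ K_m`: the class of `Y` for the equivalence relation generated by
  `X ↦ k X k'` and `X ↦ X + ϖ^N Z` (`Z` integral). Classes are equal or disjoint
  (`gjClass_eq_of_mem`), bi-`K_m`-invariant (`coe_mul_mem_gjClass_iff`,
  `mul_coe_mem_gjClass_iff`), invariant under `ϖ^N M_n(𝒪)` (`add_mem_gjClass_iff`), decreasing
  in `N` (`gjClass_mono_precision`), and twisted by `GL_n(𝒪)`: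
  `X ∈ gjClass Y ↔ κ X κ' ∈ gjClass (κ Y κ')` (`mul_mul_mem_gjClass_iff`).
* `gjPin ϖ S a = diag(ϖ^{a_i} (i ∈ S), 0 (i ∉ S))` (**definition**; for `a_i < N` the Smith normal
  forms of integral matrices modulo `ϖ^N`, `S` the set of pinned invariant factors) and
  `gjShift hϖ S = diag(1 (i ∈ S), ϖ (i ∉ S)) ∈ GL_n(F)` (**definition**, the dominant coweight of
  the cut `S ⊔ Sᶜ`); `gjPin * gjShift⁻¹ = gjPin`.
* **The membership criterion** for `D = gjPin ϖ S a`, `t = gjShift`, `g ∈ K_m` and pins with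
  `a_i + m ≤ N` on `S`: `D g t⁻¹ ∈ gjClass ϖ m N D` iff `|g_{ij}| ≤ |ϖ|^{m+1}` for `i ∈ S`,
  `j ∉ S` — "if" (`gjPin_mul_mul_shift_inv_mem_gjClass`) because then `t g t⁻¹ ∈ K_m`
  (`gjShift_mul_mul_inv_mem_congruenceGL_iff`) and `D g t⁻¹ = D (t g t⁻¹)`; "only if"
  (`valuation_apply_le_of_gjPin_mul_mul_shift_inv_mem_gjClass`) by comparing the `(i, j)` entries
  of `D g t⁻¹ k'⁻¹` (`≡ ϖ^{a_i + m - 1} X_{ij}` modulo `ϖ^{a_i + m}`, `g = 1 + ϖ^m X`) and of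
  `k D` (zero). Also `X u t⁻¹ ∈ gjClass D → X ∈ gjClass D` for `u ∈ K_m`
  (`mem_gjClass_of_mul_mul_shift_inv_mem`: `D k' t = D k''` with `k'' ∈ K_m`).
* `gjTransv hϖ hm S b = U_b = 1 + ϖ^m B` (**definition**), `B = gjTransvMatrix S b` the matrix
  supported on `S × Sᶜ` with entries the chosen lifts (`liftRes`) of a family `b` of residues;
  `gjTransvIndex` (**definition**), the family singled out by `k ∈ K_m`. Results: for `k ∈ K_m`,
  `D (k U_b) t⁻¹ ∈ gjClass ϖ m N D ↔ b = gjTransvIndex _ hk`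
  (`gjPin_mul_coe_mul_gjTransv_mul_shift_inv_mem_gjClass_iff`); hence **exactly one good shift**
  `X U_b t⁻¹ ∈ gjClass ϖ m N D` for `X` in the deeper class `gjClass ϖ m (N+1) D`
  (`exists_forall_mul_gjTransv_mul_shift_inv_mem_gjClass_iff`), **none** for `X ∉ gjClass ϖ m N D`
  (`mul_gjTransv_mul_shift_inv_not_mem_gjClass`); the `U_b` are a transversal of
  `K_m / (K_m ∩ t⁻¹ K_m t)` (`gjShift_conj_gjTransv_inv_mul_mem_iff`), so that the counts
  `#{b : X k U_b t⁻¹ ∈ C}` do not depend on `k ∈ K_m` (`exists_equiv_mul_gjTransv_mem_gjClass_iff`,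
  finite residue field).

These feed the support computation of the Hecke shift `Φ ↦ ∑_b Φ(· U_b t⁻¹)` on indicator
functions of classes in the rationality proof of the Godement–Jacquet zeta integrals.

## References

* R. Godement, H. Jacquet, *Zeta functions of simple algebras*, LNM 260 (1972), §3
  [GodementJacquet1972].
* H. Jacquet, *Principal `L`-functions of the linear group*, Proc. Sympos. Pure Math. 33 (1979),
  Part 2, §1 [JacquetCorvallis1979].
-/

set_option autoImplicit false

noncomputable section

open scoped MatrixGroups
open Matrix ValuativeRel

namespace Literature.NumberTheory.Automorphic

variable {F : Type*} [Field F] [ValuativeRel F] {n : ℕ} {ϖ : F}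

/-! ### Congruence classes modulo `ϖ^N` under `K_m × K_m` -/

section Classes

/-- **The class of `Y` modulo `ϖ^N` under `K_m × K_m`**: the matrices `X ∈ M_n(F)` with
`X - k Y k'` of entries of valuation `≤ |ϖ|^N` (i.e. `X ≡ k Y k' mod ϖ^N M_n(𝒪)`) for some
`k, k'` in the principal congruence subgroup `K_m = congruenceGL n |ϖ|^m`. For `Y` integral and
`m ≥ 1` these are the orbits of `K_m × K_m` on `M_n(𝒪 / ϖ^N)`, pulled back to `M_n(𝒪)`; the
orbits of the Smith normal forms `gjPin` are the "atoms" of the rationality proof of the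
Godement–Jacquet zeta integrals (Godement–Jacquet (1972), §3). [folklore] -/
def gjClass (ϖ : F) (m N : ℕ) (Y : Matrix (Fin n) (Fin n) F) : Set (Matrix (Fin n) (Fin n) F) :=
  {X | ∃ k ∈ congruenceGL n (valuation F ϖ ^ m), ∃ k' ∈ congruenceGL n (valuation F ϖ ^ m),
    ValBound (valuation F ϖ ^ N)
      (X - (k : Matrix (Fin n) (Fin n) F) * Y * (k' : Matrix (Fin n) (Fin n) F))}

/-- Membership in `gjClass`. [folklore] -/
theorem mem_gjClass_iff {m N : ℕ} {Y X : Matrix (Fin n) (Fin n) F} :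
    X ∈ gjClass ϖ m N Y ↔ ∃ k ∈ congruenceGL n (valuation F ϖ ^ m),
      ∃ k' ∈ congruenceGL n (valuation F ϖ ^ m), ValBound (valuation F ϖ ^ N)
        (X - (k : Matrix (Fin n) (Fin n) F) * Y * (k' : Matrix (Fin n) (Fin n) F)) :=
  Iff.rfl

/-- Elements of a congruence subgroup are integral matrices (`ValBound 1`). [folklore] -/
theorem valBound_one_coe_of_mem_congruenceGL {γ : ValueGroupWithZero F} {k : GL (Fin n) F}
    (hk : k ∈ congruenceGL n γ) : ValBound 1 (k : Matrix (Fin n) (Fin n) F) :=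
  hk.1.1

/-- A two-sided product by integral matrices keeps an entrywise valuation bound. [folklore] -/
theorem ValBound.integral_mul_mul {γ : ValueGroupWithZero F} {M A B : Matrix (Fin n) (Fin n) F}
    (hM : ValBound γ M) (hA : ValBound 1 A) (hB : ValBound 1 B) : ValBound γ (A * M * B) := by
  have h := (hA.mul hM).mul hB
  rwa [one_mul, mul_one] at h

/-- `X ∈ gjClass Y` as soon as `X ≡ Y mod ϖ^N`. [folklore] -/
theorem mem_gjClass_of_valBound_sub {m N : ℕ} {Y X : Matrix (Fin n) (Fin n) F}
    (h : ValBound (valuation F ϖ ^ N) (X - Y)) : X ∈ gjClass ϖ m N Y :=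
  ⟨1, Subgroup.one_mem _, 1, Subgroup.one_mem _, by rwa [Units.val_one, one_mul, mul_one]⟩

/-- `Y ∈ gjClass Y`. [folklore] -/
theorem self_mem_gjClass (m N : ℕ) (Y : Matrix (Fin n) (Fin n) F) : Y ∈ gjClass ϖ m N Y :=
  mem_gjClass_of_valBound_sub (by rw [sub_self]; exact valBound_zero _)

/-- `k X k' ∈ gjClass X` for `k, k' ∈ K_m`. [folklore] -/
theorem coe_mul_mul_coe_mem_gjClass (m N : ℕ) (X : Matrix (Fin n) (Fin n) F) {k k' : GL (Fin n) F}
    (hk : k ∈ congruenceGL n (valuation F ϖ ^ m)) (hk' : k' ∈ congruenceGL n (valuation F ϖ ^ m)) :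
    (k : Matrix (Fin n) (Fin n) F) * X * (k' : Matrix (Fin n) (Fin n) F) ∈ gjClass ϖ m N X :=
  ⟨k, hk, k', hk', by rw [sub_self]; exact valBound_zero _⟩

/-- **Transitivity**: `X ∈ gjClass Y` and `X' ∈ gjClass X` give `X' ∈ gjClass Y`
(`X' - k₁ k Y k' k₁' = (X' - k₁ X k₁') + k₁ (X - k Y k') k₁'`). [folklore] -/
theorem mem_gjClass_trans {m N : ℕ} {Y X X' : Matrix (Fin n) (Fin n) F}
    (hX : X ∈ gjClass ϖ m N Y) (hX' : X' ∈ gjClass ϖ m N X) : X' ∈ gjClass ϖ m N Y := by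
  obtain ⟨k, hk, k', hk', h⟩ := hX
  obtain ⟨k₁, hk₁, k₁', hk₁', h'⟩ := hX'
  refine ⟨k₁ * k, Subgroup.mul_mem _ hk₁ hk, k' * k₁', Subgroup.mul_mem _ hk' hk₁', ?_⟩
  have e : X' - ((k₁ * k : GL (Fin n) F) : Matrix (Fin n) (Fin n) F) * Y *
      ((k' * k₁' : GL (Fin n) F) : Matrix (Fin n) (Fin n) F) =
      (X' - (k₁ : Matrix (Fin n) (Fin n) F) * X * (k₁' : Matrix (Fin n) (Fin n) F)) +
        (k₁ : Matrix (Fin n) (Fin n) F) *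
          (X - (k : Matrix (Fin n) (Fin n) F) * Y * (k' : Matrix (Fin n) (Fin n) F)) *
          (k₁' : Matrix (Fin n) (Fin n) F) := by
    simp only [Units.val_mul]; noncomm_ring
  rw [e]
  exact h'.add (h.integral_mul_mul (valBound_one_coe_of_mem_congruenceGL hk₁)
    (valBound_one_coe_of_mem_congruenceGL hk₁'))

/-- **Symmetry**: `X ∈ gjClass Y` gives `Y ∈ gjClass X`
(`Y - k⁻¹ X k'⁻¹ = -(k⁻¹ (X - k Y k') k'⁻¹)`). [folklore] -/
theorem mem_gjClass_symm {m N : ℕ} {Y X : Matrix (Fin n) (Fin n) F} (hX : X ∈ gjClass ϖ m N Y) :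
    Y ∈ gjClass ϖ m N X := by
  obtain ⟨k, hk, k', hk', h⟩ := hX
  refine ⟨k⁻¹, Subgroup.inv_mem _ hk, k'⁻¹, Subgroup.inv_mem _ hk', ?_⟩
  have e : Y - ((k⁻¹ : GL (Fin n) F) : Matrix (Fin n) (Fin n) F) * X *
      ((k'⁻¹ : GL (Fin n) F) : Matrix (Fin n) (Fin n) F) =
      -(((k⁻¹ : GL (Fin n) F) : Matrix (Fin n) (Fin n) F) *
        (X - (k : Matrix (Fin n) (Fin n) F) * Y * (k' : Matrix (Fin n) (Fin n) F)) *
        ((k'⁻¹ : GL (Fin n) F) : Matrix (Fin n) (Fin n) F)) := by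
    rw [Matrix.mul_sub, Matrix.sub_mul, neg_sub]
    congr 1
    simp only [← Matrix.mul_assoc, ← Units.val_mul, inv_mul_cancel, Units.val_one, Matrix.one_mul]
    rw [Matrix.mul_assoc, ← Units.val_mul, mul_inv_cancel, Units.val_one, Matrix.mul_one]
  rw [e]
  exact (h.integral_mul_mul (valBound_one_coe_of_mem_congruenceGL (Subgroup.inv_mem _ hk))
    (valBound_one_coe_of_mem_congruenceGL (Subgroup.inv_mem _ hk'))).neg

/-- **Classes are equal or disjoint**: if `X ∈ gjClass Y` then `gjClass X = gjClass Y`.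
[folklore] -/
theorem gjClass_eq_of_mem {m N : ℕ} {Y X : Matrix (Fin n) (Fin n) F} (hX : X ∈ gjClass ϖ m N Y) :
    gjClass ϖ m N X = gjClass ϖ m N Y :=
  Set.ext fun _ => ⟨fun h => mem_gjClass_trans hX h, fun h => mem_gjClass_trans (mem_gjClass_symm hX) h⟩

/-- Two classes with a common element coincide. [folklore] -/
theorem gjClass_eq_of_mem_of_mem {m N : ℕ} {Y Y' X : Matrix (Fin n) (Fin n) F}
    (h : X ∈ gjClass ϖ m N Y) (h' : X ∈ gjClass ϖ m N Y') : gjClass ϖ m N Y = gjClass ϖ m N Y' := by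
  rw [← gjClass_eq_of_mem h, gjClass_eq_of_mem h']

/-- **Left `K_m`-invariance** of the classes. [folklore] -/
theorem coe_mul_mem_gjClass_iff {m N : ℕ} {Y X : Matrix (Fin n) (Fin n) F} {k : GL (Fin n) F}
    (hk : k ∈ congruenceGL n (valuation F ϖ ^ m)) :
    (k : Matrix (Fin n) (Fin n) F) * X ∈ gjClass ϖ m N Y ↔ X ∈ gjClass ϖ m N Y := by
  have hmem : (k : Matrix (Fin n) (Fin n) F) * X ∈ gjClass ϖ m N X := by
    simpa using coe_mul_mul_coe_mem_gjClass m N X hk (Subgroup.one_mem _)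
  constructor
  · intro h
    rw [← gjClass_eq_of_mem h]
    exact mem_gjClass_symm hmem
  · intro h
    exact mem_gjClass_trans h hmem

/-- **Right `K_m`-invariance** of the classes. [folklore] -/
theorem mul_coe_mem_gjClass_iff {m N : ℕ} {Y X : Matrix (Fin n) (Fin n) F} {k : GL (Fin n) F}
    (hk : k ∈ congruenceGL n (valuation F ϖ ^ m)) :
    X * (k : Matrix (Fin n) (Fin n) F) ∈ gjClass ϖ m N Y ↔ X ∈ gjClass ϖ m N Y := by
  have hmem : X * (k : Matrix (Fin n) (Fin n) F) ∈ gjClass ϖ m N X := by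
    simpa using coe_mul_mul_coe_mem_gjClass m N X (Subgroup.one_mem _) hk
  constructor
  · intro h
    rw [← gjClass_eq_of_mem h]
    exact mem_gjClass_symm hmem
  · intro h
    exact mem_gjClass_trans h hmem

/-- **Invariance under `ϖ^N M_n(𝒪)`**: adding a matrix with entries of valuation `≤ |ϖ|^N` does
not change membership in a class. [folklore] -/
theorem add_mem_gjClass_iff {m N : ℕ} {Y X E : Matrix (Fin n) (Fin n) F}
    (hE : ValBound (valuation F ϖ ^ N) E) : X + E ∈ gjClass ϖ m N Y ↔ X ∈ gjClass ϖ m N Y := by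
  have hmem : X + E ∈ gjClass ϖ m N X :=
    mem_gjClass_of_valBound_sub (by rwa [add_sub_cancel_left])
  constructor
  · intro h
    rw [← gjClass_eq_of_mem h]
    exact mem_gjClass_symm hmem
  · intro h
    exact mem_gjClass_trans h hmem

/-- **The classes decrease with the precision**: for `|ϖ| ≤ 1` and `N ≤ N'`,
`gjClass ϖ m N' Y ⊆ gjClass ϖ m N Y`. [folklore] -/
theorem gjClass_mono_precision (hϖ : valuation F ϖ ≤ 1) {m N N' : ℕ} (hN : N ≤ N')
    (Y : Matrix (Fin n) (Fin n) F) : gjClass ϖ m N' Y ⊆ gjClass ϖ m N Y := by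
  rintro X ⟨k, hk, k', hk', h⟩
  exact ⟨k, hk, k', hk', h.mono (pow_le_pow_right_of_le_one' hϖ hN)⟩

/-- **Twisting by `GL_n(𝒪)`**: for `κ, κ' ∈ GL_n(𝒪)`,
`X ∈ gjClass Y ↔ κ X κ' ∈ gjClass (κ Y κ')` (the congruence subgroups being normal in `GL_n(𝒪)`,
`conj_mem_congruenceGL`). [folklore] -/
theorem mul_mul_mem_gjClass_iff {m N : ℕ} {Y X : Matrix (Fin n) (Fin n) F} {κ κ' : GL (Fin n) F}
    (hκ : κ ∈ glInt n F) (hκ' : κ' ∈ glInt n F) :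
    (κ : Matrix (Fin n) (Fin n) F) * X * (κ' : Matrix (Fin n) (Fin n) F) ∈
        gjClass ϖ m N ((κ : Matrix (Fin n) (Fin n) F) * Y * (κ' : Matrix (Fin n) (Fin n) F)) ↔
      X ∈ gjClass ϖ m N Y := by
  -- one implication for all `κ, κ'`, then apply it to the inverses
  have key : ∀ {κ κ' : GL (Fin n) F}, κ ∈ glInt n F → κ' ∈ glInt n F →
      ∀ {Y X : Matrix (Fin n) (Fin n) F}, X ∈ gjClass ϖ m N Y →
      (κ : Matrix (Fin n) (Fin n) F) * X * (κ' : Matrix (Fin n) (Fin n) F) ∈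
        gjClass ϖ m N ((κ : Matrix (Fin n) (Fin n) F) * Y * (κ' : Matrix (Fin n) (Fin n) F)) := by
    intro κ κ' hκ hκ' Y X hX
    obtain ⟨k, hk, k', hk', h⟩ := hX
    refine ⟨κ * k * κ⁻¹, conj_mem_congruenceGL hκ hk, κ'⁻¹ * k' * κ'⁻¹⁻¹,
      conj_mem_congruenceGL (Subgroup.inv_mem _ hκ') hk', ?_⟩
    have e : (κ : Matrix (Fin n) (Fin n) F) * X * (κ' : Matrix (Fin n) (Fin n) F) -
        ((κ * k * κ⁻¹ : GL (Fin n) F) : Matrix (Fin n) (Fin n) F) *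
          ((κ : Matrix (Fin n) (Fin n) F) * Y * (κ' : Matrix (Fin n) (Fin n) F)) *
          ((κ'⁻¹ * k' * κ'⁻¹⁻¹ : GL (Fin n) F) : Matrix (Fin n) (Fin n) F) =
        (κ : Matrix (Fin n) (Fin n) F) *
          (X - (k : Matrix (Fin n) (Fin n) F) * Y * (k' : Matrix (Fin n) (Fin n) F)) *
          (κ' : Matrix (Fin n) (Fin n) F) := by
      rw [inv_inv, Matrix.mul_sub, Matrix.sub_mul]
      congr 1
      simp only [Units.val_mul, Matrix.mul_assoc]
      congr 2
      rw [← Matrix.mul_assoc ((κ⁻¹ : GL (Fin n) F) : Matrix (Fin n) (Fin n) F), ← Units.val_mul,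
        inv_mul_cancel, Units.val_one, Matrix.one_mul]
      congr 1
      rw [← Matrix.mul_assoc ((κ' : GL (Fin n) F) : Matrix (Fin n) (Fin n) F), ← Units.val_mul,
        mul_inv_cancel, Units.val_one, Matrix.one_mul]
    rw [e]
    exact h.integral_mul_mul (valBound_one_of_mem_glInt hκ) (valBound_one_of_mem_glInt hκ')
  refine ⟨fun h => ?_, key hκ hκ'⟩
  have h' := key (Subgroup.inv_mem _ hκ) (Subgroup.inv_mem _ hκ') h
  have e1 : ((κ⁻¹ : GL (Fin n) F) : Matrix (Fin n) (Fin n) F) *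
      ((κ : Matrix (Fin n) (Fin n) F) * X * (κ' : Matrix (Fin n) (Fin n) F)) *
      ((κ'⁻¹ : GL (Fin n) F) : Matrix (Fin n) (Fin n) F) = X := by
    rw [← Matrix.mul_assoc, ← Matrix.mul_assoc, ← Units.val_mul, inv_mul_cancel, Units.val_one,
      Matrix.one_mul, Matrix.mul_assoc, ← Units.val_mul, mul_inv_cancel, Units.val_one,
      Matrix.mul_one]
  have e2 : ((κ⁻¹ : GL (Fin n) F) : Matrix (Fin n) (Fin n) F) *
      ((κ : Matrix (Fin n) (Fin n) F) * Y * (κ' : Matrix (Fin n) (Fin n) F)) *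
      ((κ'⁻¹ : GL (Fin n) F) : Matrix (Fin n) (Fin n) F) = Y := by
    rw [← Matrix.mul_assoc, ← Matrix.mul_assoc, ← Units.val_mul, inv_mul_cancel, Units.val_one,
      Matrix.one_mul, Matrix.mul_assoc, ← Units.val_mul, mul_inv_cancel, Units.val_one,
      Matrix.mul_one]
  rwa [e1, e2] at h'

/-- The class of an integral matrix consists of integral matrices (`|ϖ| ≤ 1`). [folklore] -/
theorem valBound_one_of_mem_gjClass (hϖ : valuation F ϖ ≤ 1) {m N : ℕ}
    {Y X : Matrix (Fin n) (Fin n) F} (hY : ValBound 1 Y) (hX : X ∈ gjClass ϖ m N Y) :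
    ValBound 1 X := by
  obtain ⟨k, hk, k', hk', h⟩ := hX
  have e : X = (X - (k : Matrix (Fin n) (Fin n) F) * Y * (k' : Matrix (Fin n) (Fin n) F)) +
      (k : Matrix (Fin n) (Fin n) F) * Y * (k' : Matrix (Fin n) (Fin n) F) := by abel
  rw [e]
  exact (h.mono (pow_le_one' hϖ N)).add (hY.integral_mul_mul
    (valBound_one_coe_of_mem_congruenceGL hk) (valBound_one_coe_of_mem_congruenceGL hk'))

end Classes

/-! ### Pinned diagonal matrices and the shift element -/

section Pins

/-- **The pinned diagonal matrix** `diag(ϖ^{a_i} (i ∈ S), 0 (i ∉ S))`: for `a_i < N` on `S` these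
are the Smith normal forms of integral matrices modulo `ϖ^N` under `GL_n(𝒪) × GL_n(𝒪)`, `S` the
set of pinned (determined) invariant factors, `Sᶜ` the factors divisible by `ϖ^N`. [folklore] -/
def gjPin (ϖ : F) (S : Finset (Fin n)) (a : Fin n → ℕ) : Matrix (Fin n) (Fin n) F :=
  Matrix.diagonal fun i => if i ∈ S then ϖ ^ a i else 0

/-- **The shift element** `diag(1 (i ∈ S), ϖ (i ∉ S)) ∈ GL_n(F)` of a cut `S ⊔ Sᶜ`: the dominant
coweight whose Hecke operator `[K_m t K_m]` shifts the precision of the unpinned block.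
[folklore] -/
def gjShift (hϖ : ϖ ≠ 0) (S : Finset (Fin n)) : GL (Fin n) F :=
  zpowDiagGL hϖ fun i => if i ∈ S then 0 else 1

omit [ValuativeRel F] in
/-- Entries of `gjPin`. [folklore] -/
@[simp] theorem gjPin_apply (S : Finset (Fin n)) (a : Fin n → ℕ) (i j : Fin n) :
    gjPin ϖ S a i j = if i = j then (if i ∈ S then ϖ ^ a i else 0) else 0 := by
  rw [gjPin, Matrix.diagonal_apply]

omit [ValuativeRel F] in
/-- The matrix of the shift element. [folklore] -/
theorem coe_gjShift (hϖ : ϖ ≠ 0) (S : Finset (Fin n)) :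
    ((gjShift hϖ S : GL (Fin n) F) : Matrix (Fin n) (Fin n) F) =
      Matrix.diagonal fun i => if i ∈ S then (1 : F) else ϖ := by
  rw [gjShift, coe_zpowDiagGL]
  congr 1
  funext i
  split_ifs <;> simp

omit [ValuativeRel F] in
/-- The matrix of the inverse shift element. [folklore] -/
theorem coe_gjShift_inv (hϖ : ϖ ≠ 0) (S : Finset (Fin n)) :
    (((gjShift hϖ S)⁻¹ : GL (Fin n) F) : Matrix (Fin n) (Fin n) F) =
      Matrix.diagonal fun i => if i ∈ S then (1 : F) else ϖ⁻¹ := by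
  rw [gjShift, ← zpowDiagGL_neg, coe_zpowDiagGL]
  congr 1
  funext i
  simp only [Pi.neg_apply]
  split_ifs <;> simp

omit [ValuativeRel F] in
/-- Entries of `M t⁻¹`: the columns outside `S` are divided by `ϖ`. [folklore] -/
theorem mul_coe_gjShift_inv_apply (hϖ : ϖ ≠ 0) (S : Finset (Fin n)) (M : Matrix (Fin n) (Fin n) F)
    (i j : Fin n) :
    (M * (((gjShift hϖ S)⁻¹ : GL (Fin n) F) : Matrix (Fin n) (Fin n) F)) i j =
      M i j * (if j ∈ S then (1 : F) else ϖ⁻¹) := by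
  rw [coe_gjShift_inv, Matrix.mul_diagonal]

omit [ValuativeRel F] in
/-- Entries of `t M t⁻¹`. [folklore] -/
theorem coe_gjShift_mul_mul_inv_apply (hϖ : ϖ ≠ 0) (S : Finset (Fin n))
    (M : Matrix (Fin n) (Fin n) F) (i j : Fin n) :
    (((gjShift hϖ S : GL (Fin n) F) : Matrix (Fin n) (Fin n) F) * M *
        (((gjShift hϖ S)⁻¹ : GL (Fin n) F) : Matrix (Fin n) (Fin n) F)) i j =
      (if i ∈ S then (1 : F) else ϖ) * M i j * (if j ∈ S then (1 : F) else ϖ⁻¹) := by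
  rw [coe_gjShift_inv, Matrix.mul_diagonal, coe_gjShift, Matrix.diagonal_mul]

omit [ValuativeRel F] in
/-- Entries of `D M` for `D = gjPin`: the rows in `S` are multiplied by `ϖ^{a_i}`, the others
vanish. [folklore] -/
theorem gjPin_mul_apply (S : Finset (Fin n)) (a : Fin n → ℕ) (M : Matrix (Fin n) (Fin n) F)
    (i j : Fin n) : (gjPin ϖ S a * M) i j = (if i ∈ S then ϖ ^ a i else 0) * M i j := by
  rw [gjPin, Matrix.diagonal_mul]

omit [ValuativeRel F] in
/-- Entries of `M D` for `D = gjPin`. [folklore] -/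
theorem mul_gjPin_apply (S : Finset (Fin n)) (a : Fin n → ℕ) (M : Matrix (Fin n) (Fin n) F)
    (i j : Fin n) : (M * gjPin ϖ S a) i j = M i j * (if j ∈ S then ϖ ^ a j else 0) := by
  rw [gjPin, Matrix.mul_diagonal]

omit [ValuativeRel F] in
/-- `D t⁻¹ = D`: the shift acts trivially on the pinned columns and the other columns of `D`
vanish. [folklore] -/
theorem gjPin_mul_coe_gjShift_inv (hϖ : ϖ ≠ 0) (S : Finset (Fin n)) (a : Fin n → ℕ) :
    gjPin ϖ S a * (((gjShift hϖ S)⁻¹ : GL (Fin n) F) : Matrix (Fin n) (Fin n) F) = gjPin ϖ S a := by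
  ext i j
  rw [mul_coe_gjShift_inv_apply, gjPin_apply]
  by_cases hij : i = j
  · subst hij
    by_cases hi : i ∈ S <;> simp [hi]
  · simp [hij]

omit [ValuativeRel F] in
/-- `D t = D`. [folklore] -/
theorem gjPin_mul_coe_gjShift (hϖ : ϖ ≠ 0) (S : Finset (Fin n)) (a : Fin n → ℕ) :
    gjPin ϖ S a * ((gjShift hϖ S : GL (Fin n) F) : Matrix (Fin n) (Fin n) F) = gjPin ϖ S a := by
  conv_lhs => rw [← gjPin_mul_coe_gjShift_inv hϖ S a]
  rw [Matrix.mul_assoc, ← Units.val_mul, inv_mul_cancel, Units.val_one, Matrix.mul_one]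

/-- `gjPin` is integral for `ϖ ∈ 𝒪`. [folklore] -/
theorem valBound_one_gjPin (hϖ : valuation F ϖ ≤ 1) (S : Finset (Fin n)) (a : Fin n → ℕ) :
    ValBound 1 (gjPin ϖ S a) := by
  intro i j
  rw [gjPin_apply]
  split_ifs
  · rw [map_pow]; exact pow_le_one' hϖ _
  · simp
  · simp

/-- The shift element is integral for `ϖ ∈ 𝒪`. [folklore] -/
theorem valBound_one_coe_gjShift (hϖ : valuation F ϖ ≤ 1) (hϖ0 : ϖ ≠ 0) (S : Finset (Fin n)) :
    ValBound 1 ((gjShift hϖ0 S : GL (Fin n) F) : Matrix (Fin n) (Fin n) F) := by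
  intro i j
  rw [coe_gjShift, Matrix.diagonal_apply]
  split_ifs <;> simp [hϖ]

/-- `ϖ t⁻¹` is integral for `ϖ ∈ 𝒪`. [folklore] -/
theorem valBound_one_smul_coe_gjShift_inv (hϖ : valuation F ϖ ≤ 1) (hϖ0 : ϖ ≠ 0)
    (S : Finset (Fin n)) :
    ValBound 1 (ϖ • (((gjShift hϖ0 S)⁻¹ : GL (Fin n) F) : Matrix (Fin n) (Fin n) F)) := by
  intro i j
  rw [Matrix.smul_apply, coe_gjShift_inv, Matrix.diagonal_apply, smul_eq_mul]
  split_ifs <;> simp [hϖ, hϖ0]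

end Pins

/-! ### The membership criterion for `D g t⁻¹` -/

section Criterion

variable {m N : ℕ} {S : Finset (Fin n)} {a : Fin n → ℕ}

/-- `|ϖ^m x| ≤ |ϖ|^{m+1} ↔ |x| ≤ |ϖ|` (`ϖ ≠ 0`). [folklore] -/
theorem valuation_pow_mul_le_pow_succ_iff (hϖ0 : ϖ ≠ 0) (m : ℕ) (x : F) :
    valuation F (ϖ ^ m * x) ≤ valuation F ϖ ^ (m + 1) ↔ valuation F x ≤ valuation F ϖ := by
  have hv : valuation F ϖ ^ m ≠ 0 := pow_ne_zero _ ((Valuation.ne_zero_iff _).mpr hϖ0)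
  rw [map_mul, map_pow, pow_succ]
  exact mul_le_mul_iff_right₀ (zero_lt_iff.mpr hv)

/-- **Conjugating by the shift**: if `g = 1 + ϖ^m X ∈ K_m` has the entries `g_{ij}`, `i ∈ S`,
`j ∉ S`, of valuation `≤ |ϖ|^{m+1}`, then `t g t⁻¹ ∈ K_m` (`t = gjShift`; the block `S × Sᶜ` of
`X` is divided by `ϖ`, the block `Sᶜ × S` multiplied by `ϖ`). [folklore] -/
theorem gjShift_mul_mul_inv_mem_congruenceGL (hϖ : IsUniformizingElement ϖ) (hm : 1 ≤ m)
    {g : GL (Fin n) F} (hg : g ∈ congruenceGL n (valuation F ϖ ^ m))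
    (hsmall : ∀ i ∈ S, ∀ j ∉ S, valuation F ((g : Matrix (Fin n) (Fin n) F) i j) ≤
      valuation F ϖ ^ (m + 1)) :
    gjShift hϖ.ne_zero S * g * (gjShift hϖ.ne_zero S)⁻¹ ∈ congruenceGL n (valuation F ϖ ^ m) := by
  obtain ⟨X, hX, hgX⟩ := exists_eq_one_add_smul_of_mem_congruenceGL hϖ.ne_zero hg
  -- the conjugated matrix `t X t⁻¹` is integral
  set X' : Matrix (Fin n) (Fin n) F := ((gjShift hϖ.ne_zero S : GL (Fin n) F) : Matrix (Fin n) (Fin n) F) *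
    X * (((gjShift hϖ.ne_zero S)⁻¹ : GL (Fin n) F) : Matrix (Fin n) (Fin n) F) with hX'def
  have hX' : IsIntegralMatrix X' := by
    intro i j
    rw [hX'def, coe_gjShift_mul_mul_inv_apply]
    by_cases hi : i ∈ S <;> by_cases hj : j ∈ S
    · simpa [hi, hj] using hX i j
    · -- `i ∈ S`, `j ∉ S`: `X_{ij} / ϖ`, integral by the smallness hypothesis
      simp only [hi, hj, if_true, if_false, one_mul]
      have h1 : (g : Matrix (Fin n) (Fin n) F) i j = ϖ ^ m * X i j := by
        rw [hgX, Matrix.add_apply, Matrix.one_apply_ne (by rintro rfl; exact hj hi),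
          Matrix.smul_apply, smul_eq_mul, zero_add]
      have h2 := hsmall i hi j hj
      rw [h1, valuation_pow_mul_le_pow_succ_iff hϖ.ne_zero] at h2
      rw [Valuation.mem_integer_iff, map_mul, map_inv₀]
      calc valuation F (X i j) * (valuation F ϖ)⁻¹ ≤ valuation F ϖ * (valuation F ϖ)⁻¹ :=
            mul_le_mul_left h2 _
        _ = 1 := mul_inv_cancel₀ ((Valuation.ne_zero_iff _).mpr hϖ.ne_zero)
    · simp only [hi, hj, if_true, if_false, mul_one]
      exact Subring.mul_mem _ hϖ.mem (hX i j)
    · simp only [hi, hj, if_false]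
      rw [mul_comm ϖ, mul_assoc, mul_inv_cancel₀ hϖ.ne_zero, mul_one]
      exact hX i j
  refine mem_congruenceGL_of_coe_eq_one_add_smul hϖ hm hX' ?_
  rw [Units.val_mul, Units.val_mul, hgX, Matrix.mul_add, Matrix.add_mul, Matrix.mul_one,
    ← Units.val_mul, mul_inv_cancel, Units.val_one, Matrix.mul_smul, Matrix.smul_mul, hX'def]

/-- **The "if" half of the criterion**: for `g ∈ K_m` (`m ≥ 1`) with `|g_{ij}| ≤ |ϖ|^{m+1}` for
`i ∈ S`, `j ∉ S`, the matrix `D g t⁻¹ = D (t g t⁻¹)` lies in `gjClass D` (`D = gjPin`,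
`t = gjShift`). [folklore] -/
theorem gjPin_mul_mul_shift_inv_mem_gjClass (hϖ : IsUniformizingElement ϖ) (hm : 1 ≤ m)
    {g : GL (Fin n) F} (hg : g ∈ congruenceGL n (valuation F ϖ ^ m))
    (hsmall : ∀ i ∈ S, ∀ j ∉ S, valuation F ((g : Matrix (Fin n) (Fin n) F) i j) ≤
      valuation F ϖ ^ (m + 1)) :
    gjPin ϖ S a * (g : Matrix (Fin n) (Fin n) F) *
        (((gjShift hϖ.ne_zero S)⁻¹ : GL (Fin n) F) : Matrix (Fin n) (Fin n) F) ∈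
      gjClass ϖ m N (gjPin ϖ S a) := by
  have hmem := gjShift_mul_mul_inv_mem_congruenceGL hϖ hm hg hsmall
  have e : gjPin ϖ S a * (g : Matrix (Fin n) (Fin n) F) *
      (((gjShift hϖ.ne_zero S)⁻¹ : GL (Fin n) F) : Matrix (Fin n) (Fin n) F) =
      ((1 : GL (Fin n) F) : Matrix (Fin n) (Fin n) F) * gjPin ϖ S a *
        ((gjShift hϖ.ne_zero S * g * (gjShift hϖ.ne_zero S)⁻¹ : GL (Fin n) F) :
          Matrix (Fin n) (Fin n) F) := by
    rw [Units.val_one, Matrix.one_mul, Units.val_mul, Units.val_mul, ← Matrix.mul_assoc,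
      ← Matrix.mul_assoc, gjPin_mul_coe_gjShift]
  rw [e]
  exact coe_mul_mul_coe_mem_gjClass m N _ (Subgroup.one_mem _) hmem

/-- `|ϖ|^b ≤ |ϖ|^a` for `a ≤ b` when `|ϖ| ≤ 1`. [folklore] -/
theorem valuation_pow_le_pow_of_le (hϖ : valuation F ϖ ≤ 1) {a b : ℕ} (h : a ≤ b) :
    valuation F ϖ ^ b ≤ valuation F ϖ ^ a :=
  pow_le_pow_right_of_le_one' hϖ h

/-- An entry of `K_m` off the diagonal has valuation `≤ |ϖ|^m`. [folklore] -/
theorem valuation_apply_le_of_mem_congruenceGL_of_ne {γ : ValueGroupWithZero F} {k : GL (Fin n) F}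
    (hk : k ∈ congruenceGL n γ) {i j : Fin n} (hij : i ≠ j) :
    valuation F ((k : Matrix (Fin n) (Fin n) F) i j) ≤ γ := by
  have h := hk.2.1 i j
  rwa [Matrix.sub_apply, Matrix.one_apply_ne hij, sub_zero] at h

/-- A diagonal entry of `K_m` is `1` plus an element of valuation `≤ |ϖ|^m`; for `|ϖ|^m < 1` it has
valuation `1`. [folklore] -/
theorem valuation_apply_self_eq_one_of_mem_congruenceGL {γ : ValueGroupWithZero F} (hγ : γ < 1)
    {k : GL (Fin n) F} (hk : k ∈ congruenceGL n γ) (i : Fin n) :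
    valuation F ((k : Matrix (Fin n) (Fin n) F) i i) = 1 := by
  have h := hk.2.1 i i
  rw [Matrix.sub_apply, Matrix.one_apply_eq] at h
  have e : (k : Matrix (Fin n) (Fin n) F) i i = 1 + ((k : Matrix (Fin n) (Fin n) F) i i - 1) := by
    ring
  rw [e]
  exact (valuation F).map_one_add_of_lt (lt_of_le_of_lt h hγ)

/-- **The "only if" half of the criterion.** Let `m ≥ 1`, `g ∈ K_m`, and let the pins satisfy the
gap condition `a_i + m ≤ N` for `i ∈ S`. If `D g t⁻¹ ∈ gjClass ϖ m N D` (`D = gjPin ϖ S a`,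
`t = gjShift`), then `|g_{ij}| ≤ |ϖ|^{m+1}` for all `i ∈ S`, `j ∉ S`. Proof: with
`D g t⁻¹ ≡ k D k' (mod ϖ^N)`, the `(i, j)` entry of `D g t⁻¹ k'⁻¹` is `≡ 0 (mod ϖ^N)` (the
`j`-th column of `k D` vanishes), while it equals `ϖ^{a_i} g_{ij} ϖ⁻¹ (k'⁻¹)_{jj}` plus terms of
valuation `≤ |ϖ|^{a_i + m}`; since `|(k'⁻¹)_{jj}| = 1` and `N ≥ a_i + m`, this forces
`|ϖ^{a_i - 1} g_{ij}| ≤ |ϖ|^{a_i + m}`. [folklore] -/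
theorem valuation_apply_le_of_gjPin_mul_mul_shift_inv_mem_gjClass (hϖ : IsUniformizingElement ϖ)
    (hm : 1 ≤ m) (hgap : ∀ i ∈ S, a i + m ≤ N)
    {g : GL (Fin n) F} (hg : g ∈ congruenceGL n (valuation F ϖ ^ m))
    (hmem : gjPin ϖ S a * (g : Matrix (Fin n) (Fin n) F) *
        (((gjShift hϖ.ne_zero S)⁻¹ : GL (Fin n) F) : Matrix (Fin n) (Fin n) F) ∈
      gjClass ϖ m N (gjPin ϖ S a)) :
    ∀ i ∈ S, ∀ j ∉ S, valuation F ((g : Matrix (Fin n) (Fin n) F) i j) ≤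
      valuation F ϖ ^ (m + 1) := by
  classical
  intro i hi j hj
  have hij : i ≠ j := by rintro rfl; exact hj hi
  have hϖle : valuation F ϖ ≤ 1 := hϖ.valuation_le_one
  have hv0 : valuation F ϖ ≠ 0 := (Valuation.ne_zero_iff _).mpr hϖ.ne_zero
  have hγ1 : valuation F ϖ ^ m < 1 := hϖ.valuation_pow_lt_one hm
  obtain ⟨k, hk, k', hk', h⟩ := hmem
  set D := gjPin ϖ S a with hD
  set tinv : Matrix (Fin n) (Fin n) F :=
    (((gjShift hϖ.ne_zero S)⁻¹ : GL (Fin n) F) : Matrix (Fin n) (Fin n) F) with htinv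
  set h' : Matrix (Fin n) (Fin n) F := ((k'⁻¹ : GL (Fin n) F) : Matrix (Fin n) (Fin n) F) with hh'
  have hk'inv : k'⁻¹ ∈ congruenceGL n (valuation F ϖ ^ m) := Subgroup.inv_mem _ hk'
  -- `D g t⁻¹ k'⁻¹ ≡ k D (mod ϖ^N)`
  have h1 : ValBound (valuation F ϖ ^ N)
      (D * (g : Matrix (Fin n) (Fin n) F) * tinv * h' - (k : Matrix (Fin n) (Fin n) F) * D) := by
    have h2 := h.mul (valBound_one_coe_of_mem_congruenceGL hk'inv)
    rw [mul_one, Matrix.sub_mul, Matrix.mul_assoc ((k : Matrix (Fin n) (Fin n) F) * D),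
      ← Units.val_mul, mul_inv_cancel, Units.val_one, Matrix.mul_one] at h2
    exact h2
  -- the `(i, j)` entry of `k D` vanishes
  have hkD : ((k : Matrix (Fin n) (Fin n) F) * D) i j = 0 := by
    rw [hD, mul_gjPin_apply, if_neg hj, mul_zero]
  have hentry : valuation F ((D * (g : Matrix (Fin n) (Fin n) F) * tinv * h') i j) ≤
      valuation F ϖ ^ (a i + m) := by
    have h3 := h1 i j
    rw [Matrix.sub_apply, hkD, sub_zero] at h3
    exact h3.trans (valuation_pow_le_pow_of_le hϖle (hgap i hi))
  -- expand the entry as a sum over `l`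
  have hexp : (D * (g : Matrix (Fin n) (Fin n) F) * tinv * h') i j =
      ∑ l, ϖ ^ a i * (g : Matrix (Fin n) (Fin n) F) i l * (if l ∈ S then (1 : F) else ϖ⁻¹) *
        h' l j := by
    rw [Matrix.mul_apply]
    refine Finset.sum_congr rfl fun l _ => ?_
    rw [htinv, mul_coe_gjShift_inv_apply, hD, gjPin_mul_apply, if_pos hi]
  -- the terms `l ≠ j` are small
  have hsmall : ∀ l, l ≠ j → valuation F (ϖ ^ a i * (g : Matrix (Fin n) (Fin n) F) i l *
      (if l ∈ S then (1 : F) else ϖ⁻¹) * h' l j) ≤ valuation F ϖ ^ (a i + m) := by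
    intro l hlj
    have hh'lj : valuation F (h' l j) ≤ valuation F ϖ ^ m :=
      valuation_apply_le_of_mem_congruenceGL_of_ne hk'inv hlj
    by_cases hl : l ∈ S
    · rw [if_pos hl, mul_one, map_mul, map_mul, map_pow, pow_add]
      have hgil : valuation F ((g : Matrix (Fin n) (Fin n) F) i l) ≤ 1 :=
        valBound_one_coe_of_mem_congruenceGL hg i l
      calc valuation F ϖ ^ a i * valuation F ((g : Matrix (Fin n) (Fin n) F) i l) *
            valuation F (h' l j)
          ≤ valuation F ϖ ^ a i * 1 * valuation F ϖ ^ m :=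
            mul_le_mul' (mul_le_mul' le_rfl hgil) hh'lj
        _ = valuation F ϖ ^ a i * valuation F ϖ ^ m := by rw [mul_one]
    · have hil : i ≠ l := by rintro rfl; exact hl hi
      have hgil : valuation F ((g : Matrix (Fin n) (Fin n) F) i l) ≤ valuation F ϖ ^ m :=
        valuation_apply_le_of_mem_congruenceGL_of_ne hg hil
      rw [if_neg hl, map_mul, map_mul, map_mul, map_pow, map_inv₀]
      calc valuation F ϖ ^ a i * valuation F ((g : Matrix (Fin n) (Fin n) F) i l) *
            (valuation F ϖ)⁻¹ * valuation F (h' l j)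
          ≤ valuation F ϖ ^ a i * valuation F ϖ ^ m * (valuation F ϖ)⁻¹ * valuation F ϖ ^ m :=
            mul_le_mul' (mul_le_mul' (mul_le_mul' le_rfl hgil) le_rfl) hh'lj
        _ = valuation F ϖ ^ (a i + m) * (valuation F ϖ ^ m * (valuation F ϖ)⁻¹) := by
            rw [pow_add]; simp only [mul_assoc, mul_comm, mul_left_comm]
        _ ≤ valuation F ϖ ^ (a i + m) * 1 := by
            refine mul_le_mul' le_rfl ?_
            obtain ⟨m', rfl⟩ : ∃ m', m = m' + 1 := ⟨m - 1, by omega⟩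
            rw [pow_succ, mul_assoc, mul_inv_cancel₀ hv0, mul_one]
            exact pow_le_one' hϖle _
        _ = valuation F ϖ ^ (a i + m) := mul_one _
  have hrest : valuation F (∑ l ∈ Finset.univ.erase j, ϖ ^ a i *
      (g : Matrix (Fin n) (Fin n) F) i l * (if l ∈ S then (1 : F) else ϖ⁻¹) * h' l j) ≤
      valuation F ϖ ^ (a i + m) :=
    Valuation.map_sum_le _ fun l hl => hsmall l (Finset.ne_of_mem_erase hl)
  -- hence the term `l = j` is small
  have hterm : valuation F (ϖ ^ a i * (g : Matrix (Fin n) (Fin n) F) i j *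
      (if j ∈ S then (1 : F) else ϖ⁻¹) * h' j j) ≤ valuation F ϖ ^ (a i + m) := by
    have e : ϖ ^ a i * (g : Matrix (Fin n) (Fin n) F) i j * (if j ∈ S then (1 : F) else ϖ⁻¹) *
        h' j j = (D * (g : Matrix (Fin n) (Fin n) F) * tinv * h') i j -
        ∑ l ∈ Finset.univ.erase j, ϖ ^ a i * (g : Matrix (Fin n) (Fin n) F) i l *
          (if l ∈ S then (1 : F) else ϖ⁻¹) * h' l j := by
      rw [hexp, ← Finset.add_sum_erase _ _ (Finset.mem_univ j), add_sub_cancel_right]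
    rw [e]
    exact Valuation.map_sub_le _ hentry hrest
  -- read off `|g_{ij}|`
  have hjj : valuation F (h' j j) = 1 := valuation_apply_self_eq_one_of_mem_congruenceGL hγ1 hk'inv j
  rw [if_neg hj, map_mul, map_mul, map_mul, hjj, mul_one, map_pow, map_inv₀] at hterm
  -- `|ϖ|^{a_i} |g_{ij}| |ϖ|⁻¹ ≤ |ϖ|^{a_i + m}` gives `|g_{ij}| ≤ |ϖ|^{m+1}`
  have hpos : 0 < valuation F ϖ ^ a i := pow_pos (zero_lt_iff.mpr hv0) _
  have h4 : valuation F ϖ ^ a i * (valuation F ((g : Matrix (Fin n) (Fin n) F) i j)) ≤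
      valuation F ϖ ^ a i * valuation F ϖ ^ (m + 1) := by
    have h5 := mul_le_mul_left hterm (valuation F ϖ)
    calc valuation F ϖ ^ a i * valuation F ((g : Matrix (Fin n) (Fin n) F) i j)
        = valuation F ϖ ^ a i * valuation F ((g : Matrix (Fin n) (Fin n) F) i j) *
            (valuation F ϖ)⁻¹ * valuation F ϖ := by
          rw [mul_assoc _ ((valuation F ϖ)⁻¹), inv_mul_cancel₀ hv0, mul_one]
      _ ≤ valuation F ϖ ^ (a i + m) * valuation F ϖ := h5
      _ = valuation F ϖ ^ a i * valuation F ϖ ^ (m + 1) := by rw [pow_add, pow_succ, mul_assoc]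
  exact (mul_le_mul_iff_right₀ hpos).mp h4

/-- **Stability of the class under the shift**: for `u ∈ K_m` (`m ≥ 1`),
`X u t⁻¹ ∈ gjClass D → X ∈ gjClass D` (`D = gjPin ϖ S a`, `t = gjShift`). With
`X u t⁻¹ ≡ k D k' (mod ϖ^N)` one has `X ≡ k D k' t u⁻¹`, and `D k' t = D k''` for the element
`k'' ∈ K_m` whose rows in `S` are those of `k' t` and whose other rows are those of `k'`.
[folklore] -/
theorem mem_gjClass_of_mul_mul_shift_inv_mem (hϖ : IsUniformizingElement ϖ) (hm : 1 ≤ m)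
    {u : GL (Fin n) F} (hu : u ∈ congruenceGL n (valuation F ϖ ^ m)) {X : Matrix (Fin n) (Fin n) F}
    (hmem : X * (u : Matrix (Fin n) (Fin n) F) *
        (((gjShift hϖ.ne_zero S)⁻¹ : GL (Fin n) F) : Matrix (Fin n) (Fin n) F) ∈
      gjClass ϖ m N (gjPin ϖ S a)) :
    X ∈ gjClass ϖ m N (gjPin ϖ S a) := by
  classical
  have hϖle : valuation F ϖ ≤ 1 := hϖ.valuation_le_one
  obtain ⟨k, hk, k', hk', h⟩ := hmem
  set D := gjPin ϖ S a with hD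
  -- the modified element `k'' = 1 + ϖ^m (P X' t + (1 - P) X')`, `k' = 1 + ϖ^m X'`
  obtain ⟨X', hX', hk'X'⟩ := exists_eq_one_add_smul_of_mem_congruenceGL hϖ.ne_zero hk'
  set P : Matrix (Fin n) (Fin n) F := Matrix.diagonal fun i => if i ∈ S then (1 : F) else 0 with hP
  have hPint : IsIntegralMatrix P := fun i j => by
    rw [hP, Matrix.diagonal_apply]; split_ifs <;> simp
  have h1Pint : IsIntegralMatrix (1 - P) := fun i j => by
    rw [Matrix.sub_apply, hP, Matrix.diagonal_apply, Matrix.one_apply]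
    split_ifs <;> simp
  have htint : IsIntegralMatrix ((gjShift hϖ.ne_zero S : GL (Fin n) F) : Matrix (Fin n) (Fin n) F) :=
    fun i j => (Valuation.mem_integer_iff _ _).mpr (valBound_one_coe_gjShift hϖle hϖ.ne_zero S i j)
  set X'' : Matrix (Fin n) (Fin n) F :=
    P * X' * ((gjShift hϖ.ne_zero S : GL (Fin n) F) : Matrix (Fin n) (Fin n) F) + (1 - P) * X'
    with hX''
  have hX''int : IsIntegralMatrix X'' := fun i j => by
    rw [hX'', Matrix.add_apply]
    exact Subring.add_mem _ (((hPint.mul hX').mul htint) i j) ((h1Pint.mul hX') i j)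
  set k'' : GL (Fin n) F := Matrix.GeneralLinearGroup.mk'' (1 + ϖ ^ m • X'')
    (isUnit_det_one_add_smul hϖ hm hX''int) with hk''
  have hk''mem : k'' ∈ congruenceGL n (valuation F ϖ ^ m) :=
    mk''_one_add_smul_mem_congruenceGL hϖ hm hX''int
  have hk''coe : ((k'' : GL (Fin n) F) : Matrix (Fin n) (Fin n) F) = 1 + ϖ ^ m • X'' := rfl
  -- `D P = D`, `D (1 - P) = 0`, `D t = D`
  have hDP : D * P = D := by
    rw [hD, gjPin, hP, Matrix.diagonal_mul_diagonal]
    congr 1; funext i; split_ifs <;> simp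
  have hD1P : D * (1 - P) = 0 := by rw [Matrix.mul_sub, Matrix.mul_one, hDP, sub_self]
  have hDt : D * ((gjShift hϖ.ne_zero S : GL (Fin n) F) : Matrix (Fin n) (Fin n) F) = D :=
    gjPin_mul_coe_gjShift hϖ.ne_zero S a
  have hDk'' : D * ((k'' : GL (Fin n) F) : Matrix (Fin n) (Fin n) F) =
      D * (k' : Matrix (Fin n) (Fin n) F) *
        ((gjShift hϖ.ne_zero S : GL (Fin n) F) : Matrix (Fin n) (Fin n) F) := by
    have lhs : D * ((k'' : GL (Fin n) F) : Matrix (Fin n) (Fin n) F) =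
        D + ϖ ^ m • (D * X' * ((gjShift hϖ.ne_zero S : GL (Fin n) F) : Matrix (Fin n) (Fin n) F)) := by
      rw [hk''coe, hX'', Matrix.mul_add, Matrix.mul_one, Matrix.mul_smul, Matrix.mul_add,
        ← Matrix.mul_assoc, ← Matrix.mul_assoc, hDP, ← Matrix.mul_assoc, hD1P, Matrix.zero_mul,
        add_zero]
    have rhs : D * (k' : Matrix (Fin n) (Fin n) F) *
        ((gjShift hϖ.ne_zero S : GL (Fin n) F) : Matrix (Fin n) (Fin n) F) =
        D + ϖ ^ m • (D * X' * ((gjShift hϖ.ne_zero S : GL (Fin n) F) : Matrix (Fin n) (Fin n) F)) := by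
      rw [hk'X', Matrix.mul_add, Matrix.mul_one, Matrix.add_mul, hDt, Matrix.mul_smul,
        Matrix.smul_mul]
    rw [lhs, rhs]
  -- `X ≡ k D k'' u⁻¹ (mod ϖ^N)`
  refine ⟨k, hk, k'' * u⁻¹, Subgroup.mul_mem _ hk''mem (Subgroup.inv_mem _ hu), ?_⟩
  have h2 := h.mul ((valBound_one_coe_gjShift hϖle hϖ.ne_zero S).mul
    (valBound_one_coe_of_mem_congruenceGL (Subgroup.inv_mem _ hu)))
  rw [mul_one, mul_one, Matrix.sub_mul] at h2
  have hcancel : (u : Matrix (Fin n) (Fin n) F) *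
      (((gjShift hϖ.ne_zero S)⁻¹ : GL (Fin n) F) : Matrix (Fin n) (Fin n) F) *
      (((gjShift hϖ.ne_zero S : GL (Fin n) F) : Matrix (Fin n) (Fin n) F) *
        ((u⁻¹ : GL (Fin n) F) : Matrix (Fin n) (Fin n) F)) = 1 := by
    rw [← Units.val_mul, ← Units.val_mul, ← Units.val_mul,
      show u * (gjShift hϖ.ne_zero S)⁻¹ * (gjShift hϖ.ne_zero S * u⁻¹) = 1 by group, Units.val_one]
  have e1 : X * (u : Matrix (Fin n) (Fin n) F) *
      (((gjShift hϖ.ne_zero S)⁻¹ : GL (Fin n) F) : Matrix (Fin n) (Fin n) F) *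
      (((gjShift hϖ.ne_zero S : GL (Fin n) F) : Matrix (Fin n) (Fin n) F) *
        ((u⁻¹ : GL (Fin n) F) : Matrix (Fin n) (Fin n) F)) = X := by
    rw [Matrix.mul_assoc X, Matrix.mul_assoc X, hcancel, Matrix.mul_one]
  have e2 : (k : Matrix (Fin n) (Fin n) F) * gjPin ϖ S a * (k' : Matrix (Fin n) (Fin n) F) *
      (((gjShift hϖ.ne_zero S : GL (Fin n) F) : Matrix (Fin n) (Fin n) F) *
        ((u⁻¹ : GL (Fin n) F) : Matrix (Fin n) (Fin n) F)) =
      (k : Matrix (Fin n) (Fin n) F) * D * ((k'' * u⁻¹ : GL (Fin n) F) : Matrix (Fin n) (Fin n) F) := by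
    calc (k : Matrix (Fin n) (Fin n) F) * gjPin ϖ S a * (k' : Matrix (Fin n) (Fin n) F) *
          (((gjShift hϖ.ne_zero S : GL (Fin n) F) : Matrix (Fin n) (Fin n) F) *
            ((u⁻¹ : GL (Fin n) F) : Matrix (Fin n) (Fin n) F))
        = (k : Matrix (Fin n) (Fin n) F) * (D * (k' : Matrix (Fin n) (Fin n) F) *
            ((gjShift hϖ.ne_zero S : GL (Fin n) F) : Matrix (Fin n) (Fin n) F)) *
            ((u⁻¹ : GL (Fin n) F) : Matrix (Fin n) (Fin n) F) := by
          simp only [hD, Matrix.mul_assoc]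
      _ = (k : Matrix (Fin n) (Fin n) F) * (D * ((k'' : GL (Fin n) F) : Matrix (Fin n) (Fin n) F)) *
            ((u⁻¹ : GL (Fin n) F) : Matrix (Fin n) (Fin n) F) := by rw [hDk'']
      _ = (k : Matrix (Fin n) (Fin n) F) * D *
            ((k'' * u⁻¹ : GL (Fin n) F) : Matrix (Fin n) (Fin n) F) := by
          rw [Units.val_mul]; simp only [Matrix.mul_assoc]
  rw [e1, e2] at h2
  exact h2

/-- **Conjugates by the shift**: for `h ∈ K_m` (`m ≥ 1`), `t h t⁻¹ ∈ K_m` iff the block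
`S × Sᶜ` of `h` has entries of valuation `≤ |ϖ|^{m+1}`. [folklore] -/
theorem gjShift_mul_mul_inv_mem_congruenceGL_iff (hϖ : IsUniformizingElement ϖ) (hm : 1 ≤ m)
    {h : GL (Fin n) F} (hh : h ∈ congruenceGL n (valuation F ϖ ^ m)) :
    gjShift hϖ.ne_zero S * h * (gjShift hϖ.ne_zero S)⁻¹ ∈ congruenceGL n (valuation F ϖ ^ m) ↔
      ∀ i ∈ S, ∀ j ∉ S, valuation F ((h : Matrix (Fin n) (Fin n) F) i j) ≤
        valuation F ϖ ^ (m + 1) := by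
  refine ⟨fun hmem i hi j hj => ?_, gjShift_mul_mul_inv_mem_congruenceGL hϖ hm hh⟩
  have hij : i ≠ j := by rintro rfl; exact hj hi
  have h1 := valuation_apply_le_of_mem_congruenceGL_of_ne hmem hij
  rw [Units.val_mul, Units.val_mul, coe_gjShift_mul_mul_inv_apply, if_pos hi, if_neg hj, one_mul,
    map_mul, map_inv₀] at h1
  have hv0 : valuation F ϖ ≠ 0 := (Valuation.ne_zero_iff _).mpr hϖ.ne_zero
  have h2 := mul_le_mul_left h1 (valuation F ϖ)
  rwa [mul_assoc, inv_mul_cancel₀ hv0, mul_one, ← pow_succ] at h2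

end Criterion

/-! ### The transversal `U_b = 1 + ϖ^m B`, `B` supported on `S × Sᶜ` with entries in a residue
system -/

section Transversal

variable {m N : ℕ} {S : Finset (Fin n)} {a : Fin n → ℕ}

/-- For a uniformizing element `ϖ` and `x ∈ 𝒪`: `|x| < 1 ↔ |x| ≤ |ϖ|`. [folklore] -/
theorem valuation_lt_one_iff_le_uniformizer (hϖ : IsUniformizingElement ϖ) {x : F} (hx : x ∈ 𝒪[F]) :
    valuation F x < 1 ↔ valuation F x ≤ valuation F ϖ := by
  constructor
  · intro h
    obtain ⟨y, hy, rfl⟩ := hϖ.exists_eq_mul hx h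
    rw [map_mul]
    exact mul_le_of_le_one_right' ((Valuation.mem_integer_iff _ _).mp hy)
  · exact fun h => lt_of_le_of_lt h hϖ.valuation_lt_one

/-- **Residues and valuations**: two elements of `𝒪` have the same residue iff their difference
has valuation `≤ |ϖ|` (`ϖ` a uniformizing element). [folklore] -/
theorem residue_eq_residue_iff (hϖ : IsUniformizingElement ϖ) (y z : 𝒪[F]) :
    IsLocalRing.residue 𝒪[F] y = IsLocalRing.residue 𝒪[F] z ↔
      valuation F ((y : F) - z) ≤ valuation F ϖ := by
  rw [← sub_eq_zero, ← map_sub, show ((y : F) - z) = ((y - z : 𝒪[F]) : F) from rfl,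
    ← valuation_lt_one_iff_le_uniformizer hϖ (y - z).2]
  constructor
  · intro h; exact valuation_lt_one_of_residue_eq_zero h
  · intro h; exact residue_eq_zero_of_valuation_lt_one h

variable (S) in
/-- The matrix `B` of a family `b` of residues indexed by `S × Sᶜ`: `B_{ij}` is the chosen lift
`liftRes (b (i, j))` for `i ∈ S`, `j ∉ S`, and `0` elsewhere. [folklore] -/
def gjTransvMatrix (b : {i : Fin n // i ∈ S} × {j : Fin n // j ∉ S} → 𝓀[F]) :
    Matrix (Fin n) (Fin n) F :=
  Matrix.of fun i j => if h : i ∈ S ∧ j ∉ S then ((liftRes (b (⟨i, h.1⟩, ⟨j, h.2⟩)) : 𝒪[F]) : F)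
    else 0

/-- Entries of `gjTransvMatrix`. [folklore] -/
theorem gjTransvMatrix_apply (b : {i : Fin n // i ∈ S} × {j : Fin n // j ∉ S} → 𝓀[F]) (i j : Fin n) :
    gjTransvMatrix S b i j = if h : i ∈ S ∧ j ∉ S then
      ((liftRes (b (⟨i, h.1⟩, ⟨j, h.2⟩)) : 𝒪[F]) : F) else 0 := by
  rw [gjTransvMatrix, Matrix.of_apply]

/-- `gjTransvMatrix` is integral. [folklore] -/
theorem isIntegralMatrix_gjTransvMatrix (b : {i : Fin n // i ∈ S} × {j : Fin n // j ∉ S} → 𝓀[F]) :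
    IsIntegralMatrix (gjTransvMatrix S b) := by
  intro i j
  rw [gjTransvMatrix_apply]
  split_ifs
  · exact SetLike.coe_mem _
  · exact Subring.zero_mem _

/-- **The transversal elements** `U_b = 1 + ϖ^m B ∈ K_m` (`m ≥ 1`), `B = gjTransvMatrix S b`; as `b`
runs over the families of residues indexed by `S × Sᶜ`, the `U_b` form a transversal of
`K_m / (K_m ∩ t⁻¹ K_m t)`, `t = gjShift` (`existsUnique_gjShift_conj_inv_mul_mem`). [folklore] -/
def gjTransv (hϖ : IsUniformizingElement ϖ) (hm : 1 ≤ m) (S : Finset (Fin n))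
    (b : {i : Fin n // i ∈ S} × {j : Fin n // j ∉ S} → 𝓀[F]) : GL (Fin n) F :=
  Matrix.GeneralLinearGroup.mk'' (1 + ϖ ^ m • gjTransvMatrix S b)
    (isUnit_det_one_add_smul hϖ hm (isIntegralMatrix_gjTransvMatrix b))

/-- The matrix of `U_b`. [folklore] -/
theorem coe_gjTransv (hϖ : IsUniformizingElement ϖ) (hm : 1 ≤ m)
    (b : {i : Fin n // i ∈ S} × {j : Fin n // j ∉ S} → 𝓀[F]) :
    ((gjTransv hϖ hm S b : GL (Fin n) F) : Matrix (Fin n) (Fin n) F) =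
      1 + ϖ ^ m • gjTransvMatrix S b :=
  rfl

/-- `U_b ∈ K_m`. [folklore] -/
theorem gjTransv_mem_congruenceGL (hϖ : IsUniformizingElement ϖ) (hm : 1 ≤ m)
    (b : {i : Fin n // i ∈ S} × {j : Fin n // j ∉ S} → 𝓀[F]) :
    gjTransv hϖ hm S b ∈ congruenceGL n (valuation F ϖ ^ m) :=
  mk''_one_add_smul_mem_congruenceGL hϖ hm (isIntegralMatrix_gjTransvMatrix b)

/-- **The block `S × Sᶜ` of `k U_b` modulo `ϖ^{m+1}`**: for `k ∈ K_m` (`m ≥ 1`), `i ∈ S`, `j ∉ S`,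
`(k U_b)_{ij} ≡ k_{ij} + ϖ^m B_{ij} (mod ϖ^{m+1})`. [folklore] -/
theorem valuation_coe_mul_gjTransv_apply_sub_le (hϖ : IsUniformizingElement ϖ) (hm : 1 ≤ m)
    {k : GL (Fin n) F} (hk : k ∈ congruenceGL n (valuation F ϖ ^ m))
    (b : {i : Fin n // i ∈ S} × {j : Fin n // j ∉ S} → 𝓀[F]) {i j : Fin n} (hi : i ∈ S) (hj : j ∉ S) :
    valuation F (((k * gjTransv hϖ hm S b : GL (Fin n) F) : Matrix (Fin n) (Fin n) F) i j -
      ((k : Matrix (Fin n) (Fin n) F) i j + ϖ ^ m * gjTransvMatrix S b i j)) ≤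
      valuation F ϖ ^ (m + 1) := by
  classical
  have hij : i ≠ j := by rintro rfl; exact hj hi
  have hϖle : valuation F ϖ ≤ 1 := hϖ.valuation_le_one
  have hBint := isIntegralMatrix_gjTransvMatrix (S := S) b
  -- expand `(k U_b)_{ij} = k_{ij} + ϖ^m ∑_l k_{il} B_{lj}`
  have hexp : ((k * gjTransv hϖ hm S b : GL (Fin n) F) : Matrix (Fin n) (Fin n) F) i j =
      (k : Matrix (Fin n) (Fin n) F) i j +
        ϖ ^ m * ∑ l, (k : Matrix (Fin n) (Fin n) F) i l * gjTransvMatrix S b l j := by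
    rw [Units.val_mul, coe_gjTransv, Matrix.mul_add, Matrix.mul_one, Matrix.add_apply,
      Matrix.mul_smul, Matrix.smul_apply, smul_eq_mul, Matrix.mul_apply]
  -- isolate the term `l = i`
  have hsum : ∑ l, (k : Matrix (Fin n) (Fin n) F) i l * gjTransvMatrix S b l j =
      (k : Matrix (Fin n) (Fin n) F) i i * gjTransvMatrix S b i j +
        ∑ l ∈ Finset.univ.erase i, (k : Matrix (Fin n) (Fin n) F) i l * gjTransvMatrix S b l j :=
    (Finset.add_sum_erase _ _ (Finset.mem_univ i)).symm
  have e : ((k * gjTransv hϖ hm S b : GL (Fin n) F) : Matrix (Fin n) (Fin n) F) i j -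
      ((k : Matrix (Fin n) (Fin n) F) i j + ϖ ^ m * gjTransvMatrix S b i j) =
      ϖ ^ m * (((k : Matrix (Fin n) (Fin n) F) i i - 1) * gjTransvMatrix S b i j) +
        ϖ ^ m * ∑ l ∈ Finset.univ.erase i,
          (k : Matrix (Fin n) (Fin n) F) i l * gjTransvMatrix S b l j := by
    rw [hexp, hsum]; ring
  rw [e]
  have hv : ∀ x : F, valuation F x ≤ valuation F ϖ ^ m →
      valuation F (ϖ ^ m * x) ≤ valuation F ϖ ^ (m + 1) := by
    intro x hx
    rw [map_mul, map_pow, pow_succ]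
    refine mul_le_mul' le_rfl (hx.trans ?_)
    obtain ⟨m', rfl⟩ : ∃ m', m = m' + 1 := ⟨m - 1, by omega⟩
    rw [pow_succ]
    exact mul_le_of_le_one_left' (pow_le_one' hϖle _)
  refine Valuation.map_add_le _ (hv _ ?_) (hv _ (Valuation.map_sum_le _ fun l hl => ?_))
  · rw [map_mul]
    have h1 : valuation F ((k : Matrix (Fin n) (Fin n) F) i i - 1) ≤ valuation F ϖ ^ m := by
      have := hk.2.1 i i
      rwa [Matrix.sub_apply, Matrix.one_apply_eq] at this
    exact (mul_le_mul' h1 ((Valuation.mem_integer_iff _ _).mp (hBint i j))).trans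
      (le_of_eq (mul_one _))
  · rw [map_mul]
    have h1 : valuation F ((k : Matrix (Fin n) (Fin n) F) i l) ≤ valuation F ϖ ^ m :=
      valuation_apply_le_of_mem_congruenceGL_of_ne hk (Finset.ne_of_mem_erase hl).symm
    exact (mul_le_mul' h1 ((Valuation.mem_integer_iff _ _).mp (hBint l j))).trans
      (le_of_eq (mul_one _))

/-- An off-diagonal entry `k_{ij}` of `k ∈ K_m` divided by `ϖ^m` is integral. [folklore] -/
theorem inv_pow_mul_apply_mem_integer (hϖ0 : ϖ ≠ 0) {k : GL (Fin n) F}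
    (hk : k ∈ congruenceGL n (valuation F ϖ ^ m)) {i j : Fin n} (hij : i ≠ j) :
    (ϖ ^ m)⁻¹ * (k : Matrix (Fin n) (Fin n) F) i j ∈ 𝒪[F] := by
  have hv : valuation F ϖ ^ m ≠ 0 := pow_ne_zero _ ((Valuation.ne_zero_iff _).mpr hϖ0)
  rw [Valuation.mem_integer_iff, map_mul, map_inv₀, map_pow]
  calc (valuation F ϖ ^ m)⁻¹ * valuation F ((k : Matrix (Fin n) (Fin n) F) i j)
      ≤ (valuation F ϖ ^ m)⁻¹ * valuation F ϖ ^ m :=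
        mul_le_mul_right (valuation_apply_le_of_mem_congruenceGL_of_ne hk hij) _
    _ = 1 := inv_mul_cancel₀ hv

/-- **The residue family singled out by `k ∈ K_m`**: `b₀(i, j) = - residue (ϖ^{-m} k_{ij})`, the
unique `b` with `k U_b ∈ t⁻¹ K_m t` (`valuation_coe_mul_gjTransv_apply_le_iff`). [folklore] -/
def gjTransvIndex (hϖ0 : ϖ ≠ 0) {k : GL (Fin n) F} (hk : k ∈ congruenceGL n (valuation F ϖ ^ m)) :
    {i : Fin n // i ∈ S} × {j : Fin n // j ∉ S} → 𝓀[F] :=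
  fun p => -IsLocalRing.residue 𝒪[F]
    ⟨(ϖ ^ m)⁻¹ * (k : Matrix (Fin n) (Fin n) F) p.1 p.2, inv_pow_mul_apply_mem_integer hϖ0 hk
      (by rintro h; exact p.2.2 (h ▸ p.1.2))⟩

/-- **Smallness of the block of `k U_b` singles out one `b`**: for `k ∈ K_m` (`m ≥ 1`), `i ∈ S`,
`j ∉ S`: `|(k U_b)_{ij}| ≤ |ϖ|^{m+1} ↔ b (i, j) = b₀ (i, j)`, `b₀ = gjTransvIndex`. [folklore] -/
theorem valuation_coe_mul_gjTransv_apply_le_iff (hϖ : IsUniformizingElement ϖ) (hm : 1 ≤ m)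
    {k : GL (Fin n) F} (hk : k ∈ congruenceGL n (valuation F ϖ ^ m))
    (b : {i : Fin n // i ∈ S} × {j : Fin n // j ∉ S} → 𝓀[F]) {i j : Fin n} (hi : i ∈ S) (hj : j ∉ S) :
    valuation F (((k * gjTransv hϖ hm S b : GL (Fin n) F) : Matrix (Fin n) (Fin n) F) i j) ≤
        valuation F ϖ ^ (m + 1) ↔
      b (⟨i, hi⟩, ⟨j, hj⟩) = gjTransvIndex hϖ.ne_zero hk (⟨i, hi⟩, ⟨j, hj⟩) := by
  have hij : i ≠ j := by rintro rfl; exact hj hi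
  have hpow : ϖ ^ m ≠ 0 := pow_ne_zero _ hϖ.ne_zero
  have hsmallE := valuation_coe_mul_gjTransv_apply_sub_le hϖ hm hk b hi hj
  -- replace `(k U_b)_{ij}` by `k_{ij} + ϖ^m B_{ij}`
  have step1 : valuation F (((k * gjTransv hϖ hm S b : GL (Fin n) F) : Matrix (Fin n) (Fin n) F) i j) ≤
      valuation F ϖ ^ (m + 1) ↔
      valuation F ((k : Matrix (Fin n) (Fin n) F) i j + ϖ ^ m * gjTransvMatrix S b i j) ≤
        valuation F ϖ ^ (m + 1) := by
    constructor
    · intro h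
      have := Valuation.map_sub_le _ h hsmallE
      rwa [sub_sub_cancel] at this
    · intro h
      have := Valuation.map_add_le _ hsmallE h
      rwa [sub_add_cancel] at this
  rw [step1]
  -- rewrite `k_{ij} + ϖ^m B_{ij} = ϖ^m (ϖ^{-m} k_{ij} + B_{ij})`
  have e : (k : Matrix (Fin n) (Fin n) F) i j + ϖ ^ m * gjTransvMatrix S b i j =
      ϖ ^ m * (gjTransvMatrix S b i j - (-((ϖ ^ m)⁻¹ * (k : Matrix (Fin n) (Fin n) F) i j))) := by
    rw [sub_neg_eq_add, mul_add, ← mul_assoc, mul_inv_cancel₀ hpow, one_mul, add_comm]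
  rw [e, valuation_pow_mul_le_pow_succ_iff hϖ.ne_zero, gjTransvMatrix_apply, dif_pos ⟨hi, hj⟩]
  have key := residue_eq_residue_iff hϖ (liftRes (b (⟨i, hi⟩, ⟨j, hj⟩)))
    (-⟨(ϖ ^ m)⁻¹ * (k : Matrix (Fin n) (Fin n) F) i j, inv_pow_mul_apply_mem_integer hϖ.ne_zero hk hij⟩)
  rw [residue_liftRes, map_neg] at key
  rw [show ((-⟨(ϖ ^ m)⁻¹ * (k : Matrix (Fin n) (Fin n) F) i j,
      inv_pow_mul_apply_mem_integer hϖ.ne_zero hk hij⟩ : 𝒪[F]) : F) =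
      -((ϖ ^ m)⁻¹ * (k : Matrix (Fin n) (Fin n) F) i j) from rfl] at key
  rw [← key]
  rfl

/-- **The criterion for `D (k U_b) t⁻¹`**: for `k ∈ K_m` (`m ≥ 1`) and pins with `a_i + m ≤ N` on
`S`, `D (k U_b) t⁻¹ ∈ gjClass ϖ m N D ↔ b = gjTransvIndex _ hk`. [folklore] -/
theorem gjPin_mul_coe_mul_gjTransv_mul_shift_inv_mem_gjClass_iff (hϖ : IsUniformizingElement ϖ)
    (hm : 1 ≤ m) (hgap : ∀ i ∈ S, a i + m ≤ N)
    {k : GL (Fin n) F} (hk : k ∈ congruenceGL n (valuation F ϖ ^ m))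
    (b : {i : Fin n // i ∈ S} × {j : Fin n // j ∉ S} → 𝓀[F]) :
    gjPin ϖ S a * ((k * gjTransv hϖ hm S b : GL (Fin n) F) : Matrix (Fin n) (Fin n) F) *
        (((gjShift hϖ.ne_zero S)⁻¹ : GL (Fin n) F) : Matrix (Fin n) (Fin n) F) ∈
        gjClass ϖ m N (gjPin ϖ S a) ↔
      b = gjTransvIndex hϖ.ne_zero hk := by
  have hkU : k * gjTransv hϖ hm S b ∈ congruenceGL n (valuation F ϖ ^ m) :=
    Subgroup.mul_mem _ hk (gjTransv_mem_congruenceGL hϖ hm b)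
  constructor
  · intro h
    have hsmall := valuation_apply_le_of_gjPin_mul_mul_shift_inv_mem_gjClass hϖ hm hgap hkU h
    funext ⟨⟨i, hi⟩, ⟨j, hj⟩⟩
    exact (valuation_coe_mul_gjTransv_apply_le_iff hϖ hm hk b hi hj).mp (hsmall i hi j hj)
  · intro h
    refine gjPin_mul_mul_shift_inv_mem_gjClass hϖ hm hkU fun i hi j hj => ?_
    exact (valuation_coe_mul_gjTransv_apply_le_iff hϖ hm hk b hi hj).mpr (by rw [h])

/-- `t⁻¹` has entries of valuation `≤ |ϖ|⁻¹` (for `ϖ ∈ 𝒪`). [folklore] -/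
theorem valBound_coe_gjShift_inv (hϖ : IsUniformizingElement ϖ) (S : Finset (Fin n)) :
    ValBound (valuation F ϖ)⁻¹ (((gjShift hϖ.ne_zero S)⁻¹ : GL (Fin n) F) : Matrix (Fin n) (Fin n) F) := by
  have hv0 : valuation F ϖ ≠ 0 := (Valuation.ne_zero_iff _).mpr hϖ.ne_zero
  have h1 : (1 : ValueGroupWithZero F) ≤ (valuation F ϖ)⁻¹ := one_le_inv₀ (zero_lt_iff.mpr hv0)
    |>.mpr hϖ.valuation_le_one
  intro i j
  rw [coe_gjShift_inv, Matrix.diagonal_apply]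
  split_ifs
  · simpa using h1
  · rw [map_inv₀]
  · simp

/-- **Exactly one good shift for a deeper element.** Let `m ≥ 1`, the pins satisfy `a_i + m ≤ N`
on `S`, and `X ∈ gjClass ϖ m (N + 1) D` (`D = gjPin ϖ S a`). Then there is exactly one family of
residues `b₀` such that `X U_b t⁻¹ ∈ gjClass ϖ m N D` iff `b = b₀` (`U_b = gjTransv`,
`t = gjShift`): writing `X ≡ k D k' (mod ϖ^{N+1})`, `X U_b t⁻¹ ≡ k (D (k' U_b) t⁻¹) (mod ϖ^N)`
and the criterion applies to `k' U_b`. [folklore] -/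
theorem exists_forall_mul_gjTransv_mul_shift_inv_mem_gjClass_iff (hϖ : IsUniformizingElement ϖ)
    (hm : 1 ≤ m) (hgap : ∀ i ∈ S, a i + m ≤ N) {X : Matrix (Fin n) (Fin n) F}
    (hX : X ∈ gjClass ϖ m (N + 1) (gjPin ϖ S a)) :
    ∃ b₀ : {i : Fin n // i ∈ S} × {j : Fin n // j ∉ S} → 𝓀[F], ∀ b,
      X * ((gjTransv hϖ hm S b : GL (Fin n) F) : Matrix (Fin n) (Fin n) F) *
          (((gjShift hϖ.ne_zero S)⁻¹ : GL (Fin n) F) : Matrix (Fin n) (Fin n) F) ∈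
          gjClass ϖ m N (gjPin ϖ S a) ↔ b = b₀ := by
  obtain ⟨k, hk, k', hk', h⟩ := hX
  refine ⟨gjTransvIndex hϖ.ne_zero hk', fun b => ?_⟩
  rw [← gjPin_mul_coe_mul_gjTransv_mul_shift_inv_mem_gjClass_iff hϖ hm hgap hk' b]
  -- `X U_b t⁻¹ = k (D k' U_b t⁻¹) + E U_b t⁻¹` with `E` small
  set E := X - (k : Matrix (Fin n) (Fin n) F) * gjPin ϖ S a * (k' : Matrix (Fin n) (Fin n) F) with hE
  set U : Matrix (Fin n) (Fin n) F := ((gjTransv hϖ hm S b : GL (Fin n) F) : Matrix (Fin n) (Fin n) F)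
    with hU
  set tinv : Matrix (Fin n) (Fin n) F :=
    (((gjShift hϖ.ne_zero S)⁻¹ : GL (Fin n) F) : Matrix (Fin n) (Fin n) F) with htinv
  have hEsmall : ValBound (valuation F ϖ ^ N) (E * U * tinv) := by
    have h1 := (h.mul (valBound_one_coe_of_mem_congruenceGL (gjTransv_mem_congruenceGL hϖ hm b))).mul
      (valBound_coe_gjShift_inv hϖ S)
    rw [mul_one] at h1
    refine h1.mono (le_of_eq ?_)
    rw [pow_succ, mul_assoc, mul_inv_cancel₀ ((Valuation.ne_zero_iff _).mpr hϖ.ne_zero), mul_one]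
  have e : X * U * tinv = (k : Matrix (Fin n) (Fin n) F) *
      (gjPin ϖ S a * ((k' * gjTransv hϖ hm S b : GL (Fin n) F) : Matrix (Fin n) (Fin n) F) * tinv) +
      E * U * tinv := by
    rw [hE, Units.val_mul, ← hU]
    noncomm_ring
  rw [e, add_mem_gjClass_iff hEsmall, coe_mul_mem_gjClass_iff hk]

/-- **No good shift outside the class**: if `X ∉ gjClass ϖ m N D` then `X U_b t⁻¹ ∉ gjClass ϖ m N D`
for every `b` (`mem_gjClass_of_mul_mul_shift_inv_mem`). [folklore] -/
theorem mul_gjTransv_mul_shift_inv_not_mem_gjClass (hϖ : IsUniformizingElement ϖ) (hm : 1 ≤ m)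
    {X : Matrix (Fin n) (Fin n) F} (hX : X ∉ gjClass ϖ m N (gjPin ϖ S a))
    (b : {i : Fin n // i ∈ S} × {j : Fin n // j ∉ S} → 𝓀[F]) :
    X * ((gjTransv hϖ hm S b : GL (Fin n) F) : Matrix (Fin n) (Fin n) F) *
        (((gjShift hϖ.ne_zero S)⁻¹ : GL (Fin n) F) : Matrix (Fin n) (Fin n) F) ∉
      gjClass ϖ m N (gjPin ϖ S a) :=
  fun h => hX (mem_gjClass_of_mul_mul_shift_inv_mem hϖ hm (gjTransv_mem_congruenceGL hϖ hm b) h)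

/-- **The `U_b` form a transversal of `K_m / (K_m ∩ t⁻¹ K_m t)`**: for `g ∈ K_m` (`m ≥ 1`) there
is exactly one `b` with `t (U_b⁻¹ g) t⁻¹ ∈ K_m`, namely `b = gjTransvIndex _ (g⁻¹ ∈ K_m)`
(invert: `t (g⁻¹ U_b) t⁻¹ ∈ K_m` iff the block `S × Sᶜ` of `g⁻¹ U_b` is small). [folklore] -/
theorem gjShift_conj_gjTransv_inv_mul_mem_iff (hϖ : IsUniformizingElement ϖ) (hm : 1 ≤ m)
    {g : GL (Fin n) F} (hg : g ∈ congruenceGL n (valuation F ϖ ^ m))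
    (b : {i : Fin n // i ∈ S} × {j : Fin n // j ∉ S} → 𝓀[F]) :
    gjShift hϖ.ne_zero S * ((gjTransv hϖ hm S b)⁻¹ * g) * (gjShift hϖ.ne_zero S)⁻¹ ∈
        congruenceGL n (valuation F ϖ ^ m) ↔
      b = gjTransvIndex hϖ.ne_zero (Subgroup.inv_mem _ hg) := by
  have hginv : g⁻¹ ∈ congruenceGL n (valuation F ϖ ^ m) := Subgroup.inv_mem _ hg
  have hh : g⁻¹ * gjTransv hϖ hm S b ∈ congruenceGL n (valuation F ϖ ^ m) :=
    Subgroup.mul_mem _ hginv (gjTransv_mem_congruenceGL hϖ hm b)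
  -- pass to the inverse `t (g⁻¹ U_b) t⁻¹`
  have e : gjShift hϖ.ne_zero S * ((gjTransv hϖ hm S b)⁻¹ * g) * (gjShift hϖ.ne_zero S)⁻¹ =
      (gjShift hϖ.ne_zero S * (g⁻¹ * gjTransv hϖ hm S b) * (gjShift hϖ.ne_zero S)⁻¹)⁻¹ := by
    group
  rw [e, Subgroup.inv_mem_iff, gjShift_mul_mul_inv_mem_congruenceGL_iff hϖ hm hh]
  constructor
  · intro h
    funext ⟨⟨i, hi⟩, ⟨j, hj⟩⟩
    exact (valuation_coe_mul_gjTransv_apply_le_iff hϖ hm hginv b hi hj).mp (h i hi j hj)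
  · intro h i hi j hj
    exact (valuation_coe_mul_gjTransv_apply_le_iff hϖ hm hginv b hi hj).mpr (by rw [h])

/-- **Right `K_m`-invariance of the shifted counts.** For `k ∈ K_m` (`m ≥ 1`, finite residue field)
there is a permutation `π` of the index families with
`X (k U_b) t⁻¹ ∈ gjClass Y ↔ X U_{π b} t⁻¹ ∈ gjClass Y` for all `b`, all `X` and all `Y`:
`k U_b = U_{π b} h_b` with `t h_b t⁻¹ ∈ K_m` (`π b` the index singled out by `k U_b`), and the classes are
right-`K_m`-invariant. In particular `∑_b 𝟙[X k U_b t⁻¹ ∈ C] = ∑_b 𝟙[X U_b t⁻¹ ∈ C]`. [folklore] -/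
theorem exists_equiv_mul_gjTransv_mem_gjClass_iff [Finite 𝓀[F]] (hϖ : IsUniformizingElement ϖ)
    (hm : 1 ≤ m) {k : GL (Fin n) F} (hk : k ∈ congruenceGL n (valuation F ϖ ^ m)) :
    ∃ π : ({i : Fin n // i ∈ S} × {j : Fin n // j ∉ S} → 𝓀[F]) ≃
        ({i : Fin n // i ∈ S} × {j : Fin n // j ∉ S} → 𝓀[F]),
      ∀ (N : ℕ) (Y X : Matrix (Fin n) (Fin n) F) (b : {i : Fin n // i ∈ S} × {j : Fin n // j ∉ S} → 𝓀[F]),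
        X * ((k * gjTransv hϖ hm S b : GL (Fin n) F) : Matrix (Fin n) (Fin n) F) *
            (((gjShift hϖ.ne_zero S)⁻¹ : GL (Fin n) F) : Matrix (Fin n) (Fin n) F) ∈ gjClass ϖ m N Y ↔
          X * ((gjTransv hϖ hm S (π b) : GL (Fin n) F) : Matrix (Fin n) (Fin n) F) *
            (((gjShift hϖ.ne_zero S)⁻¹ : GL (Fin n) F) : Matrix (Fin n) (Fin n) F) ∈ gjClass ϖ m N Y := by
  classical
  set t : GL (Fin n) F := gjShift hϖ.ne_zero S with ht
  have hkU : ∀ b, k * gjTransv hϖ hm S b ∈ congruenceGL n (valuation F ϖ ^ m) := fun b =>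
    Subgroup.mul_mem _ hk (gjTransv_mem_congruenceGL hϖ hm b)
  -- the index singled out by `k U_b`
  let f : ({i : Fin n // i ∈ S} × {j : Fin n // j ∉ S} → 𝓀[F]) →
      ({i : Fin n // i ∈ S} × {j : Fin n // j ∉ S} → 𝓀[F]) := fun b =>
    gjTransvIndex hϖ.ne_zero (Subgroup.inv_mem _ (hkU b))
  have hf : ∀ b, t * ((gjTransv hϖ hm S (f b))⁻¹ * (k * gjTransv hϖ hm S b)) * t⁻¹ ∈
      congruenceGL n (valuation F ϖ ^ m) := fun b =>
    (gjShift_conj_gjTransv_inv_mul_mem_iff hϖ hm (hkU b) (f b)).mpr rfl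
  -- `f` is injective, hence bijective
  have hinj : Function.Injective f := by
    intro b₁ b₂ h12
    have h1 := hf b₁
    have h2 := hf b₂
    rw [h12] at h1
    -- `t (U_{b₂}⁻¹ U_{b₁}) t⁻¹ ∈ K_m`
    have h3 : t * ((gjTransv hϖ hm S b₂)⁻¹ * gjTransv hϖ hm S b₁) * t⁻¹ ∈
        congruenceGL n (valuation F ϖ ^ m) := by
      have h4 := Subgroup.mul_mem _ (Subgroup.inv_mem _ h2) h1
      have e : (t * ((gjTransv hϖ hm S (f b₂))⁻¹ * (k * gjTransv hϖ hm S b₂)) * t⁻¹)⁻¹ *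
          (t * ((gjTransv hϖ hm S (f b₂))⁻¹ * (k * gjTransv hϖ hm S b₁)) * t⁻¹) =
          t * ((gjTransv hϖ hm S b₂)⁻¹ * gjTransv hϖ hm S b₁) * t⁻¹ := by group
      rwa [e] at h4
    have h5 := (gjShift_conj_gjTransv_inv_mul_mem_iff hϖ hm (gjTransv_mem_congruenceGL hϖ hm b₁) b₂).mp h3
    have h6 : t * ((gjTransv hϖ hm S b₁)⁻¹ * gjTransv hϖ hm S b₁) * t⁻¹ ∈
        congruenceGL n (valuation F ϖ ^ m) := by
      rw [inv_mul_cancel, mul_one, mul_inv_cancel]; exact Subgroup.one_mem _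
    have h7 := (gjShift_conj_gjTransv_inv_mul_mem_iff hϖ hm (gjTransv_mem_congruenceGL hϖ hm b₁) b₁).mp h6
    exact h7.trans h5.symm
  have hbij : Function.Bijective f := Finite.injective_iff_bijective.mp hinj
  refine ⟨Equiv.ofBijective f hbij, fun N Y X b => ?_⟩
  rw [Equiv.ofBijective_apply]
  -- `k U_b = U_{f b} h` with `t h t⁻¹ ∈ K_m`
  set h : GL (Fin n) F := (gjTransv hϖ hm S (f b))⁻¹ * (k * gjTransv hϖ hm S b) with hh
  have hconj : t * h * t⁻¹ ∈ congruenceGL n (valuation F ϖ ^ m) := hf b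
  have e : X * ((k * gjTransv hϖ hm S b : GL (Fin n) F) : Matrix (Fin n) (Fin n) F) *
      ((t⁻¹ : GL (Fin n) F) : Matrix (Fin n) (Fin n) F) =
      X * ((gjTransv hϖ hm S (f b) : GL (Fin n) F) : Matrix (Fin n) (Fin n) F) *
        ((t⁻¹ : GL (Fin n) F) : Matrix (Fin n) (Fin n) F) *
        ((t * h * t⁻¹ : GL (Fin n) F) : Matrix (Fin n) (Fin n) F) := by
    simp only [Matrix.mul_assoc, ← Units.val_mul]
    congr 2
    rw [hh]; group
  rw [e, mul_coe_mem_gjClass_iff hconj]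

end Transversal

end Literature.NumberTheory.Automorphic
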